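import Summits.BirchSwinnertonDyer.BirchSwinnertonDyer.Theses.UniversalToricDescent
import Summits.BirchSwinnertonDyer.BirchSwinnertonDyer.Theorems.UniversalToricDescentAdditiveSplitIMCInclusionAtThreeStubFrame
import Summits.BirchSwinnertonDyer.BirchSwinnertonDyer.Theorems.UniversalToricDescentAdditiveSplitIMCInclusionAtThreeStubCharIdealPrincipal
import Summits.BirchSwinnertonDyer.BirchSwinnertonDyer.Theorems.UniversalToricDescentAdditiveSplitIMCInclusionAtThreeStubWeakRigidity
import Summits.BirchSwinnertonDyer.BirchSwinnertonDyer.Theorems.UniversalToricDescentAdditiveSplitIMCInclusionAtThreeStubDescent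
import Summits.BirchSwinnertonDyer.BirchSwinnertonDyer.Theorems.UniversalToricDescentThinCombDescentNoPseudoNullOfFacts
import Summits.BirchSwinnertonDyer.BirchSwinnertonDyer.Theorems.UniversalToricDescentBDPFrameCrossPeriodRigidity
import Summits.BirchSwinnertonDyer.BirchSwinnertonDyer.Theorems.SignedBaseChangeAnticyclotomicEisensteinDivisibilityXGrTwoModuleFinite
import Literature.NumberTheory.EllipticCurves.ToricTwoVariablePAdicLFunction
import HarnessLib

/-!
# Line `thin_comb` v4 on the WALL `AdditiveSplitIMCInclusionAtThree` (stmt-BirchSwinnertonDyer-20395) — the crux CLOSED MODULO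
# its two research stubs, and modulo those + TWO PUBLISHED NAMED FACTS, as tree theorems (helper, `--supports
# stmt-BirchSwinnertonDyer-20395`; cell `pub/bsd-wall`, lead `cruxlead-20395` g3)

The registered skeleton v4 (`Cruxes/AdditiveSplitIMCInclusionAtThree/Lines/thin_comb.lean`, commit fe810479bd67; = pen bsd-wall-pss3x g7's
v4.2 adopted) has seven stubs: `stub_frame` (p696267), `stub_charIdealPrincipal` (p692284), `stub_weakRigidity` (p694324) and
`stub_descent` (p700531) are landed theorems of this namespace; `stub_noPseudoNull` is closed MODULO Greenberg 2016 Prop. 4.1.1 and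
Tate's global Euler characteristic at totally complex fields (`DescentNoPseudoNullOfFacts.stub_noPseudoNull_of_prop411_of_tateTC`,
p701674); the two RESEARCH stubs are `stub_toricTwoVarL` (K3, ∃: a toric two-variable `3`-adic `L`-function
`IsToricTwoVarLFunction …` with its own BDP companion at the same period pair, congruent on the anticyclotomic line — Castella–Wan
Thm. 2.11 / Cor. 2.12 shape at the additive `3`, beyond print) and `stub_combDivisibility` (K2⁺ ⊕ K4, ∀ over the pinned `L₂`: torsion,
a weak reflection with `ρ G ∼ G`, `ρ L₂ ∼ L₂`, integral thin-comb divisibility — beyond print). This file records the composition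
`AdditiveSplitIMCInclusionAtThree_of` with everything landed DISCHARGED:

* `AdditiveSplitIMCInclusionAtThree_of_toricTwoVarL_of_combDivisibility_of_noPseudoNull` — the crux BY NAME from the registered
  statements of `stub_toricTwoVarL`, `stub_combDivisibility`, `stub_noPseudoNull`, verbatim as hypotheses;
* `AdditiveSplitIMCInclusionAtThree_of_toricTwoVarL_of_combDivisibility_of_prop411_of_tateTC` — the crux BY NAME from the two
  research stubs and the two published named facts `Greenberg2016.prop411_selmer_isAlmostDivisible`,
  `∀ L totally complex, GaloisCohomology.tateGlobalEulerPoincareCharacteristic L`.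

HONEST FRAMING: conditional (closure.modulo); credits nothing by itself; BSD is not proved by any of this.
-/

set_option linter.dupNamespace false
set_option autoImplicit false

noncomputable section

open scoped Classical

namespace Summit.BirchSwinnertonDyer.BirchSwinnertonDyer.Theorems.UniversalToricDescentThinCombLine

open NumberField IsDedekindDomain Field
open Literature.NumberTheory.EllipticCurves
open Literature.NumberTheory.GaloisCohomology Literature.NumberTheory.IwasawaTheory.Greenberg2016
open Summit.BirchSwinnertonDyer.BirchSwinnertonDyer.Theorems.UniversalToricDescentThinComb

/-- **The crux `AdditiveSplitIMCInclusionAtThree` from the three open stub statements of line `thin_comb` v4** (`stub_toricTwoVarL`,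
`stub_combDivisibility`, `stub_noPseudoNull`, registered signatures verbatim as hypotheses; `stub_frame`, `stub_charIdealPrincipal`,
`stub_weakRigidity`, `stub_descent` discharged by the landed theorems; the handed BDP frame is moved to K3's companion by the landed
cross-period rigidity `UniversalToricDescentTwinSplit.span_singleton_eq_of_isBDPLFunction`).
[cite: CastellaWan2023, §2.4 Thm. 2.11, Cor. 2.12] [cite: Greenberg2016Selmer, Prop. 4.1.1] -/
theorem AdditiveSplitIMCInclusionAtThree_of_toricTwoVarL_of_combDivisibility_of_noPseudoNull
    (hK3 :
      ∀ (W : WeierstrassCurve ℚ) [W.IsElliptic] [W.IsGloballyMinimal] (N : ℕ) [NeZero N] (K : Type) [Field K]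
        [NumberField K] (Dt : Literature.NumberTheory.EllipticCurves.ModularForms.ModularParametrizationData W N),
      Summit.BirchSwinnertonDyer.Rank1Residual.Additive.ClassO6 W 3 → W.HasSurjectiveModNGaloisRep 3 →
      W.analyticRank = 1 → W.conductorNorm ℤ = N → IsImaginaryQuadratic K → SatisfiesHeegnerHypothesis N K →
      ∀ (κ : ZpExtension K 3), κ.IsAnticyclotomic → ∀ (γ : Field.absoluteGaloisGroup K) [Fact (κ.IsTopGenerator γ)]
        (𝔭 : HeightOneSpectrum (𝓞 K)), ((3 : ℕ) : 𝓞 K) ∈ 𝔭.asIdeal →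
        𝔭.asIdeal.ramificationIdx (𝓞 ℚ) = 1 → 𝔭.asIdeal.inertiaDeg (𝓞 ℚ) = 1 →
      ∀ (𝔭' : HeightOneSpectrum (𝓞 K)), ((3 : ℕ) : 𝓞 K) ∈ 𝔭'.asIdeal → 𝔭' ≠ 𝔭 →
      ∀ (ι' : PadicAlgCl 3 ≃+* ℂ), Summit.BirchSwinnertonDyer.BirchSwinnertonDyer.Theorems.SchneiderFree.BranchInducesPrime 3 ι' 𝔭 →
      ∀ (κ₁ κ₂ : ZpExtension K 3) (γ₁ γ₂ : Field.absoluteGaloisGroup K) (k : ℕ)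
        [Fact (ZpExtension.IsTopGeneratorPair κ₁ κ₂ γ₁ γ₂)],
      (∀ v : HeightOneSpectrum (𝓞 K), v ≠ 𝔭 → ∀ 𝔓 ∈ v.primesAbove,
          𝔓.inertia (Field.absoluteGaloisGroup K) ≤ κ₁.kerSubgroup) →
      ZpExtension.pairKer κ₁ κ₂ ≤ κ.kerSubgroup → γ₁ * γ⁻¹ ∈ κ.kerSubgroup → γ₂ * (γ ^ (3 ^ k))⁻¹ ∈ κ.kerSubgroup →
      ∀ (ΩK : ℂ) (Ωp : ℂ_[3]) (L : UnrSeries 3), ΩK ≠ 0 → Ωp ≠ 0 →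
        IsBDPLFunction ι' 𝔭 κ γ Dt.f ΩK Ωp L →
      ∃ (ΩK' : ℂ) (Ωp' : ℂ_[3]) (L₂ : PowerSeries (PowerSeries (unrIntegers 3))) (L' : UnrSeries 3),
        ΩK' ≠ 0 ∧ Ωp' ≠ 0 ∧
        IsToricTwoVarLFunction ι' 𝔭 𝔭' κ₁ κ₂ γ₁ γ₂ Dt.f ΩK' Ωp' L₂ ∧
        IsBDPLFunction ι' 𝔭 κ γ Dt.f ΩK' Ωp' L' ∧
        ∃ u : (PowerSeries (PowerSeries (unrIntegers 3)))ˣ,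
          L₂ - u * PowerSeries.map (PowerSeries.C (R := unrIntegers 3)) L' ∈
            Ideal.span {T₂ (unrIntegers 3) - ((1 + T₁ (unrIntegers 3)) ^ (3 ^ k) - 1)})
    (hK2 :
      ∀ (W : WeierstrassCurve ℚ) [W.IsElliptic] [W.IsGloballyMinimal] (N : ℕ) [NeZero N] (K : Type) [Field K]
        [NumberField K] (Dt : Literature.NumberTheory.EllipticCurves.ModularForms.ModularParametrizationData W N),
      Summit.BirchSwinnertonDyer.Rank1Residual.Additive.ClassO6 W 3 → W.HasSurjectiveModNGaloisRep 3 →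
      W.analyticRank = 1 → W.conductorNorm ℤ = N → IsImaginaryQuadratic K → SatisfiesHeegnerHypothesis N K →
      ∀ (𝔭 : HeightOneSpectrum (𝓞 K)), ((3 : ℕ) : 𝓞 K) ∈ 𝔭.asIdeal →
        𝔭.asIdeal.ramificationIdx (𝓞 ℚ) = 1 → 𝔭.asIdeal.inertiaDeg (𝓞 ℚ) = 1 →
      ∀ (𝔭' : HeightOneSpectrum (𝓞 K)), ((3 : ℕ) : 𝓞 K) ∈ 𝔭'.asIdeal → 𝔭' ≠ 𝔭 →
      ∀ (ι' : PadicAlgCl 3 ≃+* ℂ), Summit.BirchSwinnertonDyer.BirchSwinnertonDyer.Theorems.SchneiderFree.BranchInducesPrime 3 ι' 𝔭 →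
      ∀ (κ₁ κ₂ : ZpExtension K 3) (γ₁ γ₂ : Field.absoluteGaloisGroup K)
        [Fact (ZpExtension.IsTopGeneratorPair κ₁ κ₂ γ₁ γ₂)],
      (∀ v : HeightOneSpectrum (𝓞 K), v ≠ 𝔭 → ∀ 𝔓 ∈ v.primesAbove,
          𝔓.inertia (Field.absoluteGaloisGroup K) ≤ κ₁.kerSubgroup) →
      ∀ (g : IwasawaAlgebra₂ 3),
        Literature.NumberTheory.EllipticCurves.Module.charIdeal (IwasawaAlgebra₂ 3)
          ((W.baseChange K).XGr₂ 3 κ₁ κ₂ 𝔭' γ₁ γ₂) = Ideal.span {g} →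
      ∀ (ΩK : ℂ) (Ωp : ℂ_[3]) (L₂ : PowerSeries (PowerSeries (unrIntegers 3))), ΩK ≠ 0 → Ωp ≠ 0 →
        IsToricTwoVarLFunction ι' 𝔭 𝔭' κ₁ κ₂ γ₁ γ₂ Dt.f ΩK Ωp L₂ →
      Module.IsTorsion (IwasawaAlgebra₂ 3) ((W.baseChange K).XGr₂ 3 κ₁ κ₂ 𝔭' γ₁ γ₂) ∧
      ∃ (ρ : PowerSeries (PowerSeries (unrIntegers 3)) ≃+* PowerSeries (PowerSeries (unrIntegers 3))),
        (∀ c : unrIntegers 3, ρ (const (unrIntegers 3) c) = const (unrIntegers 3) c) ∧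
        ρ (T₂ (unrIntegers 3)) ∉ Ideal.span {const (unrIntegers 3) ((3 : ℕ) : unrIntegers 3), T₂ (unrIntegers 3)} ∧
        Associated (ρ (PowerSeries.map (PowerSeries.map
          (Summit.BirchSwinnertonDyer.Rank1Residual.X11b.Halves.toUnr 3)) g))
          (PowerSeries.map (PowerSeries.map (Summit.BirchSwinnertonDyer.Rank1Residual.X11b.Halves.toUnr 3)) g) ∧
        Associated (ρ L₂) L₂ ∧
        ThinCombDvdInt (unrIntegers 3) 3
          (PowerSeries.map (PowerSeries.map (Summit.BirchSwinnertonDyer.Rank1Residual.X11b.Halves.toUnr 3)) g) L₂)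
    (hNoPN :
      ∀ (W : WeierstrassCurve ℚ) [W.IsElliptic] [W.IsGloballyMinimal] (K : Type) [Field K] [NumberField K],
      Summit.BirchSwinnertonDyer.Rank1Residual.Additive.ClassO6 W 3 → W.HasSurjectiveModNGaloisRep 3 →
      IsImaginaryQuadratic K →
      ∀ (κ : ZpExtension K 3), κ.IsAnticyclotomic → ∀ (γ : Field.absoluteGaloisGroup K) [Fact (κ.IsTopGenerator γ)]
        (𝔭 : HeightOneSpectrum (𝓞 K)), ((3 : ℕ) : 𝓞 K) ∈ 𝔭.asIdeal →
      ∀ (𝔭' : HeightOneSpectrum (𝓞 K)), ((3 : ℕ) : 𝓞 K) ∈ 𝔭'.asIdeal → 𝔭' ≠ 𝔭 →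
      ∀ (κ₁ κ₂ : ZpExtension K 3) (γ₁ γ₂ : Field.absoluteGaloisGroup K) (k : ℕ)
        [Fact (ZpExtension.IsTopGeneratorPair κ₁ κ₂ γ₁ γ₂)],
      (∀ v : HeightOneSpectrum (𝓞 K), v ≠ 𝔭 → ∀ 𝔓 ∈ v.primesAbove,
          𝔓.inertia (Field.absoluteGaloisGroup K) ≤ κ₁.kerSubgroup) →
      ZpExtension.pairKer κ₁ κ₂ ≤ κ.kerSubgroup → γ₁ * γ⁻¹ ∈ κ.kerSubgroup → γ₂ * (γ ^ (3 ^ k))⁻¹ ∈ κ.kerSubgroup →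
      Module.Finite (IwasawaAlgebra₂ 3) ((W.baseChange K).XGr₂ 3 κ₁ κ₂ 𝔭' γ₁ γ₂) →
      Module.IsTorsion (IwasawaAlgebra₂ 3) ((W.baseChange K).XGr₂ 3 κ₁ κ₂ 𝔭' γ₁ γ₂) →
      ∀ N : Submodule (IwasawaAlgebra₂ 3) ((W.baseChange K).XGr₂ 3 κ₁ κ₂ 𝔭' γ₁ γ₂),
        Literature.NumberTheory.EllipticCurves.Module.IsPseudoNull (IwasawaAlgebra₂ 3) N → Finite N) :
    Summit.BirchSwinnertonDyer.BirchSwinnertonDyer.Theses.UniversalToricDescent.AdditiveSplitIMCInclusionAtThree := by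
  intro W _ _ N _ K _ _ Dt hO6 hsurj hrk hN hK hH κ hκ γ hγ 𝔭 h3 hram hdeg 𝔭' h3' hne ι' hι ΩK Ωp L hΩK hΩp hL
  obtain ⟨κ₁, κ₂, γ₁, γ₂, k, hpair, hur₁, hker, hγ₁, hγ₂⟩ :=
    stub_frame K hK κ hκ γ hγ.out 𝔭 h3 𝔭' h3' hne
  haveI : Fact (ZpExtension.IsTopGeneratorPair κ₁ κ₂ γ₁ γ₂) := ⟨hpair⟩
  obtain ⟨g, hg⟩ := (stub_charIdealPrincipal ((W.baseChange K).XGr₂ 3 κ₁ κ₂ 𝔭' γ₁ γ₂))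
  have hg' : Literature.NumberTheory.EllipticCurves.Module.charIdeal (IwasawaAlgebra₂ 3)
      ((W.baseChange K).XGr₂ 3 κ₁ κ₂ 𝔭' γ₁ γ₂) = Ideal.span {g} := by
    simpa [Ideal.submodule_span_eq] using hg
  have hfin : Module.Finite (IwasawaAlgebra₂ 3) ((W.baseChange K).XGr₂ 3 κ₁ κ₂ 𝔭' γ₁ γ₂) :=
    Summit.BirchSwinnertonDyer.BirchSwinnertonDyer.Theorems.SignedBaseChangeAcDivFinitePiece.xGr₂_module_finite
      (W.baseChange K) 3 κ₁ κ₂ 𝔭'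
  obtain ⟨ΩK', Ωp', L₂, L', hΩK', hΩp', hL₂, hL', hcong⟩ :=
    hK3 W N K Dt hO6 hsurj hrk hN hK hH κ hκ γ 𝔭 h3 hram hdeg 𝔭' h3' hne ι' hι κ₁ κ₂ γ₁ γ₂ k
      hur₁ hker hγ₁ hγ₂ ΩK Ωp L hΩK hΩp hL
  -- cross-period rigidity (tree theorem, utd-p2 p536114): the handed frame and K3's companion span the same ideal
  have hspan : Ideal.span ({L'} : Set (UnrSeries 3)) = Ideal.span {L} :=
    Summit.BirchSwinnertonDyer.BirchSwinnertonDyer.Theorems.UniversalToricDescentTwinSplit.span_singleton_eq_of_isBDPLFunction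
      hK hκ hγ.out hΩK hΩK' hΩp hΩp' hL hL'
  obtain ⟨htors, ρ, hρc, hρT, hGsym, hLsym, hcomb⟩ :=
    hK2 W N K Dt hO6 hsurj hrk hN hK hH 𝔭 h3 hram hdeg 𝔭' h3' hne ι' hι κ₁ κ₂ γ₁ γ₂
      hur₁ g hg' ΩK' Ωp' L₂ hΩK' hΩp' hL₂
  have hdvd := stub_weakRigidity ρ hρc hρT _ L₂ hGsym hLsym hcomb
  have hPN := hNoPN W K hO6 hsurj hK κ hκ γ 𝔭 h3 𝔭' h3' hne κ₁ κ₂ γ₁ γ₂ k hur₁ hker hγ₁ hγ₂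
    hfin htors
  rw [← hspan]
  exact stub_descent W K hO6 hsurj hK κ hκ γ 𝔭 h3 𝔭' h3' hne κ₁ κ₂ γ₁ γ₂ k hur₁ hker hγ₁ hγ₂ hfin htors hPN
    g hg' L₂ L' hdvd hcong

/-- **The crux `AdditiveSplitIMCInclusionAtThree` from the two RESEARCH stubs of line `thin_comb` v4 and two PUBLISHED named facts**
(Greenberg 2016 Prop. 4.1.1; Milne ADT I Thm. 5.1 at totally complex fields): the previous theorem with `stub_noPseudoNull` supplied
by `DescentNoPseudoNullOfFacts.stub_noPseudoNull_of_prop411_of_tateTC`. This is the honest residue of the line.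
[cite: Greenberg2016Selmer, Prop. 4.1.1 (c) (§4.1 p. 15)] [cite: MilneADT2006, I Thm. 5.1 (p. 67)] -/
theorem AdditiveSplitIMCInclusionAtThree_of_toricTwoVarL_of_combDivisibility_of_prop411_of_tateTC
    (hK3 :
      ∀ (W : WeierstrassCurve ℚ) [W.IsElliptic] [W.IsGloballyMinimal] (N : ℕ) [NeZero N] (K : Type) [Field K]
        [NumberField K] (Dt : Literature.NumberTheory.EllipticCurves.ModularForms.ModularParametrizationData W N),
      Summit.BirchSwinnertonDyer.Rank1Residual.Additive.ClassO6 W 3 → W.HasSurjectiveModNGaloisRep 3 →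
      W.analyticRank = 1 → W.conductorNorm ℤ = N → IsImaginaryQuadratic K → SatisfiesHeegnerHypothesis N K →
      ∀ (κ : ZpExtension K 3), κ.IsAnticyclotomic → ∀ (γ : Field.absoluteGaloisGroup K) [Fact (κ.IsTopGenerator γ)]
        (𝔭 : HeightOneSpectrum (𝓞 K)), ((3 : ℕ) : 𝓞 K) ∈ 𝔭.asIdeal →
        𝔭.asIdeal.ramificationIdx (𝓞 ℚ) = 1 → 𝔭.asIdeal.inertiaDeg (𝓞 ℚ) = 1 →
      ∀ (𝔭' : HeightOneSpectrum (𝓞 K)), ((3 : ℕ) : 𝓞 K) ∈ 𝔭'.asIdeal → 𝔭' ≠ 𝔭 →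
      ∀ (ι' : PadicAlgCl 3 ≃+* ℂ), Summit.BirchSwinnertonDyer.BirchSwinnertonDyer.Theorems.SchneiderFree.BranchInducesPrime 3 ι' 𝔭 →
      ∀ (κ₁ κ₂ : ZpExtension K 3) (γ₁ γ₂ : Field.absoluteGaloisGroup K) (k : ℕ)
        [Fact (ZpExtension.IsTopGeneratorPair κ₁ κ₂ γ₁ γ₂)],
      (∀ v : HeightOneSpectrum (𝓞 K), v ≠ 𝔭 → ∀ 𝔓 ∈ v.primesAbove,
          𝔓.inertia (Field.absoluteGaloisGroup K) ≤ κ₁.kerSubgroup) →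
      ZpExtension.pairKer κ₁ κ₂ ≤ κ.kerSubgroup → γ₁ * γ⁻¹ ∈ κ.kerSubgroup → γ₂ * (γ ^ (3 ^ k))⁻¹ ∈ κ.kerSubgroup →
      ∀ (ΩK : ℂ) (Ωp : ℂ_[3]) (L : UnrSeries 3), ΩK ≠ 0 → Ωp ≠ 0 →
        IsBDPLFunction ι' 𝔭 κ γ Dt.f ΩK Ωp L →
      ∃ (ΩK' : ℂ) (Ωp' : ℂ_[3]) (L₂ : PowerSeries (PowerSeries (unrIntegers 3))) (L' : UnrSeries 3),
        ΩK' ≠ 0 ∧ Ωp' ≠ 0 ∧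
        IsToricTwoVarLFunction ι' 𝔭 𝔭' κ₁ κ₂ γ₁ γ₂ Dt.f ΩK' Ωp' L₂ ∧
        IsBDPLFunction ι' 𝔭 κ γ Dt.f ΩK' Ωp' L' ∧
        ∃ u : (PowerSeries (PowerSeries (unrIntegers 3)))ˣ,
          L₂ - u * PowerSeries.map (PowerSeries.C (R := unrIntegers 3)) L' ∈
            Ideal.span {T₂ (unrIntegers 3) - ((1 + T₁ (unrIntegers 3)) ^ (3 ^ k) - 1)})
    (hK2 :
      ∀ (W : WeierstrassCurve ℚ) [W.IsElliptic] [W.IsGloballyMinimal] (N : ℕ) [NeZero N] (K : Type) [Field K]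
        [NumberField K] (Dt : Literature.NumberTheory.EllipticCurves.ModularForms.ModularParametrizationData W N),
      Summit.BirchSwinnertonDyer.Rank1Residual.Additive.ClassO6 W 3 → W.HasSurjectiveModNGaloisRep 3 →
      W.analyticRank = 1 → W.conductorNorm ℤ = N → IsImaginaryQuadratic K → SatisfiesHeegnerHypothesis N K →
      ∀ (𝔭 : HeightOneSpectrum (𝓞 K)), ((3 : ℕ) : 𝓞 K) ∈ 𝔭.asIdeal →
        𝔭.asIdeal.ramificationIdx (𝓞 ℚ) = 1 → 𝔭.asIdeal.inertiaDeg (𝓞 ℚ) = 1 →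
      ∀ (𝔭' : HeightOneSpectrum (𝓞 K)), ((3 : ℕ) : 𝓞 K) ∈ 𝔭'.asIdeal → 𝔭' ≠ 𝔭 →
      ∀ (ι' : PadicAlgCl 3 ≃+* ℂ), Summit.BirchSwinnertonDyer.BirchSwinnertonDyer.Theorems.SchneiderFree.BranchInducesPrime 3 ι' 𝔭 →
      ∀ (κ₁ κ₂ : ZpExtension K 3) (γ₁ γ₂ : Field.absoluteGaloisGroup K)
        [Fact (ZpExtension.IsTopGeneratorPair κ₁ κ₂ γ₁ γ₂)],
      (∀ v : HeightOneSpectrum (𝓞 K), v ≠ 𝔭 → ∀ 𝔓 ∈ v.primesAbove,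
          𝔓.inertia (Field.absoluteGaloisGroup K) ≤ κ₁.kerSubgroup) →
      ∀ (g : IwasawaAlgebra₂ 3),
        Literature.NumberTheory.EllipticCurves.Module.charIdeal (IwasawaAlgebra₂ 3)
          ((W.baseChange K).XGr₂ 3 κ₁ κ₂ 𝔭' γ₁ γ₂) = Ideal.span {g} →
      ∀ (ΩK : ℂ) (Ωp : ℂ_[3]) (L₂ : PowerSeries (PowerSeries (unrIntegers 3))), ΩK ≠ 0 → Ωp ≠ 0 →
        IsToricTwoVarLFunction ι' 𝔭 𝔭' κ₁ κ₂ γ₁ γ₂ Dt.f ΩK Ωp L₂ →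
      Module.IsTorsion (IwasawaAlgebra₂ 3) ((W.baseChange K).XGr₂ 3 κ₁ κ₂ 𝔭' γ₁ γ₂) ∧
      ∃ (ρ : PowerSeries (PowerSeries (unrIntegers 3)) ≃+* PowerSeries (PowerSeries (unrIntegers 3))),
        (∀ c : unrIntegers 3, ρ (const (unrIntegers 3) c) = const (unrIntegers 3) c) ∧
        ρ (T₂ (unrIntegers 3)) ∉ Ideal.span {const (unrIntegers 3) ((3 : ℕ) : unrIntegers 3), T₂ (unrIntegers 3)} ∧
        Associated (ρ (PowerSeries.map (PowerSeries.map
          (Summit.BirchSwinnertonDyer.Rank1Residual.X11b.Halves.toUnr 3)) g))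
          (PowerSeries.map (PowerSeries.map (Summit.BirchSwinnertonDyer.Rank1Residual.X11b.Halves.toUnr 3)) g) ∧
        Associated (ρ L₂) L₂ ∧
        ThinCombDvdInt (unrIntegers 3) 3
          (PowerSeries.map (PowerSeries.map (Summit.BirchSwinnertonDyer.Rank1Residual.X11b.Halves.toUnr 3)) g) L₂)
    (h411 : prop411_selmer_isAlmostDivisible)
    (hT : ∀ (L : Type) [Field L] [NumberField L] [IsTotallyComplex L], tateGlobalEulerPoincareCharacteristic L) :
    Summit.BirchSwinnertonDyer.BirchSwinnertonDyer.Theses.UniversalToricDescent.AdditiveSplitIMCInclusionAtThree :=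
  AdditiveSplitIMCInclusionAtThree_of_toricTwoVarL_of_combDivisibility_of_noPseudoNull hK3 hK2
    (DescentNoPseudoNullOfFacts.stub_noPseudoNull_of_prop411_of_tateTC h411 hT)

end Summit.BirchSwinnertonDyer.BirchSwinnertonDyer.Theorems.UniversalToricDescentThinCombLine

end
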